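import Literature.NumberTheory.GaloisRepresentations.CoinducedKummerSequencePiecesPositiveDegree
import Literature.NumberTheory.GaloisRepresentations.SUnitsRestrictedCohomologyDegreeTwoTorsionFinite
import Literature.NumberTheory.GaloisRepresentations.SUnitsRestrictedKummer
import Literature.NumberTheory.NumberFields.EquivariantSUnitReduction
import Literature.NumberTheory.GaloisRepresentations.ContinuousCohomologyMulEquivTransport
import HarnessLib

/-!
# The Kummer pieces for `E_S` at a finite Galois layer `E/F₀` inside `K_S`: the arithmetic inputs
# (finiteness of `𝓗¹(E_S)` and of `𝓗²(E_S)[p]`; `𝓗⁰(E_S) = 𝒪ˣ_{E,S}` as a `Gal(E/F₀)`-module)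

Topic `NumberTheory/GaloisRepresentations`; namespace `Literature.NumberTheory.GaloisRepresentations.SUnits.Layers`.  THEOREMS ONLY (no definition,
no named fact, no `sorry`, no instance).

SETTING (the currency of PT3-TC / F1b): `K` a number field, `S` a finite set of finite places of `K`,
`H ≤ Γ_K` open with `N_S ≤ H`, `U := galoisGroupAbove S H = H/N_S ≤ G_{K,S}`, `F₀ := baseField H = K̄^H`,
`E_S|_U := resRep K S H`; a finite Galois layer `E : GalLayer K` with `F₀ ≤ E ⊆ K_S` (`hF`, `hS`),
`W := layerSubgroup S hHo E hF hS = Gal(K_S/E)` (open normal in `↥U`), `Δ := ↥U ⧸ W ≃* Gal(E/F₀)`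
(`layerEquiv`); `𝓗ⁿ(A) := Hⁿ(↥U, Maps(Δ, A))` (right-action model, `ContinuousShapiroOpenCoinducedRightAction`).

* (§1 = `ContinuousCohomologyMulEquivTransport`: `Hq` along an isomorphism of topological groups.)
* §2 the layer subgroup `W ≤ ↥U` IS the open subgroup `galoisGroupAbove S (H ⊓ Gal(K̄/E))` of `G_{K,S}`
  (`mem_layerSubgroup_iff_coe_mem_galoisGroupAbove`, `exists_continuousMulEquiv_layerSubgroup`).
* §3 FINITENESS: `𝓗¹(E_S)` is finite (F1b `finite_continuousCohomology_one_resRep` at `H ⊓ Gal(K̄/E)` + §1 +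
  Shapiro `shapiroOpenAddEquiv`); for `K` totally complex the `p`-torsion of `𝓗²(E_S)` is finite (F2b);
  `E_S^W ≅ 𝒪ˣ_{E,S}` ((A2-β2) `layerModuleEquiv`) is finitely generated, so `E_S^W/p`, `E_S^W[p]` are finite.
* §4 **`𝓗⁰(E_S) = E_S^W = 𝒪ˣ_{E,S}` as a `Δ`-module** in `ψ`-form: for every additive invariant `ψ` of finite
  `p`-torsion `ℤ[Δ]`-modules (B3a-β binders; strict-implicit instance binders as in `AdditiveInvariantExactPieces`),
  `ψ(E_S^W/p) = ψ((𝒪ˣ_{E,S}/p) ∘ layerEquiv)` and `ψ(E_S^W[p]) = ψ((𝒪ˣ_{E,S}[p]) ∘ layerEquiv)`, with B7c's object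
  `EquivariantSUnit.sUnitsRepρ K S F₀ E` pulled back along `layerEquiv` (via `layerModuleEquiv_comm`).  The
  `p`-divisibility of `E_S|_U` (`S ⊇ S_p`) is (A1c) `SUnits.zsmul_surjective_sUnitsRestricted` verbatim.

Lane «TATE-EPC-TC» of cell `bsd-eis` (crux `GoodLatticeBDPValue`, stmt-BirchSwinnertonDyer-19032), brick
B8-arith ≡ B6b, arithmetic part (β).  HONEST FRAMING: bookkeeping of landed theorems; no statement of a Summit,
not Tate's formula, not the crux is proved here.

## References
* J. Neukirch, A. Schmidt, K. Wingberg, *Cohomology of Number Fields*, 2nd ed. (2008), VIII §3, (8.3.11), (8.7.2),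
  I §6 (Shapiro). [NeukirchSchmidtWingberg2008]
* J.-P. Serre, *Cohomologie galoisienne* (1994), I §2.2 Prop. 8, §2.5 Prop. 10. [SerreGaloisCohomology1997]
* D. Harari, *Galois Cohomology and Class Field Theory* (2020), §13.1, §17.4. [Harari2020]
-/

noncomputable section

open CategoryTheory Function Submodule
open NumberField IsDedekindDomain Field Topology
open scoped Pointwise

universe u

namespace Literature.NumberTheory.GaloisRepresentations

open _root_.TopRep _root_.ContRepresentation _root_.ContinuousCohomology



namespace SUnits

namespace Layers

open Literature.NumberTheory.GaloisRepresentations.IdeleClassBar (GalLayer)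
open Literature.NumberTheory.GaloisRepresentations.LocalWeilDatum (galFixing mem_galFixing_iff isOpen_galFixing)
open Literature.NumberTheory.IwasawaTheory.Greenberg2006 (galoisGroupAbove mem_galoisGroupAbove_iff)
open Literature.NumberTheory.GaloisRepresentations.OpenSubgroupLayer (algOfLE isScalarTower_algOfLE baseField
  toAbove toAbove_surjective toAbove_mem_layerSubgroup_iff)
open Literature.NumberTheory.NumberFields (EquivariantSUnit.sUnitsRepρ EquivariantSUnit.finite_setOf_under_mem)
open Literature.RepresentationTheory.FiniteGroups.StableLatticeReduction (Int.finite_quotient_smul_top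
  Int.additive_reduction_eq_of_linearEquiv smul_top_le_comap torsionBy_le_comap)

variable {K : Type} [Field K] [NumberField K] {S : Set (HeightOneSpectrum (𝓞 K))}
  {H : Subgroup (absoluteGaloisGroup K)}

/-! ## §2 The layer subgroup `W = Gal(K_S/E) ≤ ↥U` is the open subgroup `galoisGroupAbove S (H ⊓ Gal(K̄/E))` -/

omit [NumberField K] in
/-- `H ⊓ Gal(K̄/E)` is open for `H` open and `E/K` finite. [cite: NeukirchANT1999, Ch. IV §1] -/
theorem isOpen_inf_galFixing (hHo : IsOpen (H : Set (absoluteGaloisGroup K))) (E : GalLayer K) :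
    IsOpen ((H ⊓ galFixing K E.1 : Subgroup (absoluteGaloisGroup K)) : Set (absoluteGaloisGroup K)) := by
  haveI := E.finiteDimensional
  rw [Subgroup.coe_inf]
  exact hHo.inter (isOpen_galFixing K E.1)

omit [NumberField K] in
/-- `N_S ≤ H ⊓ Gal(K̄/E)` when `N_S ≤ H` and `E ⊆ K_S`. [cite: NeukirchSchmidtWingberg2008, VIII §3] -/
theorem ramificationSubgroup_le_inf_galFixing (hNH : ramificationSubgroup K S ≤ H) (E : GalLayer K)
    (hS : ramificationSubgroup K S ≤ galFixing K E.1) :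
    ramificationSubgroup K S ≤ H ⊓ galFixing K E.1 :=
  le_inf hNH hS

/-- **Membership in the layer subgroup, read in `G_{K,S}`**: `u ∈ Gal(K_S/E) ≤ ↥U` iff `u`, as an element
of `G_{K,S}`, lies in `galoisGroupAbove S (H ⊓ Gal(K̄/E))`. [cite: NeukirchSchmidtWingberg2008, VIII §3]
[cite: SerreGaloisCohomology1997, I §2.2 Prop. 8] -/
theorem mem_layerSubgroup_iff_coe_mem_galoisGroupAbove (hHo : IsOpen (H : Set (absoluteGaloisGroup K)))
    (E : GalLayer K) (hF : baseField H ≤ E.1) (hS : ramificationSubgroup K S ≤ galFixing K E.1)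
    (u : ↥(galoisGroupAbove S H)) :
    u ∈ OpenSubgroupLayer.layerSubgroup S hHo E hF hS ↔
      (u : GaloisGroupUnramifiedOutside K S) ∈ galoisGroupAbove S (H ⊓ galFixing K E.1) := by
  obtain ⟨σ, rfl⟩ := toAbove_surjective S H u
  rw [toAbove_mem_layerSubgroup_iff, mem_galoisGroupAbove_iff]
  constructor
  · intro hσ
    exact ⟨σ, ⟨σ.2, hσ⟩, rfl⟩
  · rintro ⟨τ, ⟨hτH, hτE⟩, hτ⟩
    have hτσ : toAbove S H ⟨τ, hτH⟩ = toAbove S H σ := Subtype.ext hτ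
    have hτE' : ((⟨τ, hτH⟩ : H) : absoluteGaloisGroup K) ∈ galFixing K E.1 := hτE
    rw [← (toAbove_mem_layerSubgroup_iff S hHo E hF hS ⟨τ, hτH⟩), hτσ] at hτE'
    exact (toAbove_mem_layerSubgroup_iff S hHo E hF hS σ).1 hτE'

/-- **The layer subgroup as an open subgroup of `G_{K,S}`**: a topological group isomorphism
`Gal(K_S/E) (≤ ↥U) ≃ₜ* galoisGroupAbove S (H ⊓ Gal(K̄/E))` over `G_{K,S}` (both are the same subset of
`G_{K,S}`). [cite: NeukirchSchmidtWingberg2008, VIII §3] [cite: SerreGaloisCohomology1997, I §2.2 Prop. 8] -/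
theorem exists_continuousMulEquiv_layerSubgroup (hHo : IsOpen (H : Set (absoluteGaloisGroup K)))
    (E : GalLayer K) (hF : baseField H ≤ E.1) (hS : ramificationSubgroup K S ≤ galFixing K E.1) :
    ∃ e : ↥((OpenSubgroupLayer.layerSubgroup S hHo E hF hS : OpenNormalSubgroup ↥(galoisGroupAbove S H)) :
        Subgroup ↥(galoisGroupAbove S H)) ≃ₜ* ↥(galoisGroupAbove S (H ⊓ galFixing K E.1)),
      ∀ w, ((e w : ↥(galoisGroupAbove S (H ⊓ galFixing K E.1))) : GaloisGroupUnramifiedOutside K S) =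
        ((w : ↥(galoisGroupAbove S H)) : GaloisGroupUnramifiedOutside K S) := by
  let W : Subgroup ↥(galoisGroupAbove S H) :=
    (OpenSubgroupLayer.layerSubgroup S hHo E hF hS : OpenNormalSubgroup ↥(galoisGroupAbove S H))
  have hmem : ∀ u : ↥(galoisGroupAbove S H), u ∈ W ↔
      (u : GaloisGroupUnramifiedOutside K S) ∈ galoisGroupAbove S (H ⊓ galFixing K E.1) :=
    fun u => mem_layerSubgroup_iff_coe_mem_galoisGroupAbove hHo E hF hS u
  have hle : galoisGroupAbove S (H ⊓ galFixing K E.1) ≤ galoisGroupAbove S H :=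
    Subgroup.map_mono inf_le_left
  let φ : ↥W ≃* ↥(galoisGroupAbove S (H ⊓ galFixing K E.1)) :=
    { toFun := fun w => ⟨((w : ↥(galoisGroupAbove S H)) : GaloisGroupUnramifiedOutside K S), (hmem _).1 w.2⟩
      invFun := fun g => ⟨⟨(g : GaloisGroupUnramifiedOutside K S), hle g.2⟩, (hmem _).2 g.2⟩
      left_inv := fun w => rfl
      right_inv := fun g => rfl
      map_mul' := fun a b => rfl }
  refine ⟨{ φ with
      continuous_toFun := ?_
      continuous_invFun := ?_ }, fun w => rfl⟩
  · exact Continuous.subtype_mk (continuous_subtype_val.comp continuous_subtype_val) _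
  · exact Continuous.subtype_mk (Continuous.subtype_mk continuous_subtype_val _) _

/-! ## §3 Finiteness of `𝓗¹(E_S)` and of `𝓗²(E_S)[p]` in the coinduced model; `E_S^W/p`, `E_S^W[p]` -/

section Finiteness

variable (hHo : IsOpen (H : Set (absoluteGaloisGroup K))) (hNH : ramificationSubgroup K S ≤ H)
  (hfin : S.Finite) (E : GalLayer K) (hF : baseField H ≤ E.1) (hS : ramificationSubgroup K S ≤ galFixing K E.1)

include hNH hfin in
/-- **`H¹(Gal(K_S/E), E_S)` is finite**, for the layer subgroup `Gal(K_S/E) ≤ ↥U` acting through `E_S|_U`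
(F1b at the open subgroup `H ⊓ Gal(K̄/E)`, transported along §2's isomorphism).
[cite: NeukirchSchmidtWingberg2008, VIII §3 (8.3.11) (ii)] -/
theorem finite_continuousCohomology_one_restrict_layerSubgroup :
    Finite (continuousCohomology 1 ((resRep K S H).restrict (subgroupIncl
      ((OpenSubgroupLayer.layerSubgroup S hHo E hF hS : OpenNormalSubgroup ↥(galoisGroupAbove S H)) :
        Subgroup ↥(galoisGroupAbove S H)))).toTopRep) := by
  obtain ⟨e, he⟩ := exists_continuousMulEquiv_layerSubgroup hHo E hF hS
  haveI := finite_continuousCohomology_one_resRep (S := S) (isOpen_inf_galFixing hHo E)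
    (ramificationSubgroup_le_inf_galFixing hNH E hS) hfin
  obtain ⟨f⟩ := nonempty_continuousCohomology_addEquiv_of_continuousMulEquiv e
    (resRep K S (H ⊓ galFixing K E.1)) ((resRep K S H).restrict (subgroupIncl _)) (fun w m => by
      change (sUnitsRestricted K S) ((w : ↥(galoisGroupAbove S H)) : GaloisGroupUnramifiedOutside K S) m =
        (sUnitsRestricted K S) ((e w : ↥(galoisGroupAbove S (H ⊓ galFixing K E.1))) :
          GaloisGroupUnramifiedOutside K S) m
      rw [he]) 1
  exact Finite.of_equiv _ f.toEquiv.symm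

include hNH hfin in
/-- **The `p`-torsion of `H²(Gal(K_S/E), E_S)` is finite** (`K` totally complex), for the layer subgroup
`Gal(K_S/E) ≤ ↥U` (F2b at `H ⊓ Gal(K̄/E)`, transported along §2's isomorphism).
[cite: NeukirchSchmidtWingberg2008, VIII §3 (8.3.11) (iii)] -/
theorem finite_torsion_continuousCohomology_two_restrict_layerSubgroup [IsTotallyComplex K] {p : ℕ}
    (hp : 0 < p) :
    {y : continuousCohomology 2 ((resRep K S H).restrict (subgroupIncl
      ((OpenSubgroupLayer.layerSubgroup S hHo E hF hS : OpenNormalSubgroup ↥(galoisGroupAbove S H)) :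
        Subgroup ↥(galoisGroupAbove S H)))).toTopRep | p • y = 0}.Finite := by
  obtain ⟨e, he⟩ := exists_continuousMulEquiv_layerSubgroup hHo E hF hS
  have hfin' := finite_torsion_continuousCohomology_two_resRep (S := S) (isOpen_inf_galFixing hHo E)
    (ramificationSubgroup_le_inf_galFixing hNH E hS) hfin hp
  obtain ⟨f⟩ := nonempty_continuousCohomology_addEquiv_of_continuousMulEquiv e
    (resRep K S (H ⊓ galFixing K E.1)) ((resRep K S H).restrict (subgroupIncl _)) (fun w m => by
      change (sUnitsRestricted K S) ((w : ↥(galoisGroupAbove S H)) : GaloisGroupUnramifiedOutside K S) m =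
        (sUnitsRestricted K S) ((e w : ↥(galoisGroupAbove S (H ⊓ galFixing K E.1))) :
          GaloisGroupUnramifiedOutside K S) m
      rw [he]) 2
  refine (hfin'.image f.symm).subset fun y hy => ⟨f y, ?_, f.symm_apply_apply y⟩
  have hy' : p • y = 0 := hy
  change p • f y = 0
  rw [← map_nsmul, hy', map_zero]

variable [CompactSpace ↥(galoisGroupAbove S H)]

include hNH hfin in
/-- **`𝓗¹(E_S) = H¹(↥U, Maps(Δ, E_S))` is finite** (Shapiro `shapiroOpenAddEquiv` + the previous lemma).
[cite: NeukirchSchmidtWingberg2008, VIII §3 (8.3.11) (ii), I §6 Prop. (1.6.4)] -/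
theorem finite_continuousCohomology_one_coindOpen_layer :
    Finite (continuousCohomology 1 ((resRep K S H).coindOpen
      ((OpenSubgroupLayer.layerSubgroup S hHo E hF hS : OpenNormalSubgroup ↥(galoisGroupAbove S H)) :
        Subgroup ↥(galoisGroupAbove S H))
      (OpenSubgroupLayer.layerSubgroup S hHo E hF hS).isOpen').toTopRep) := by
  haveI := totallyDisconnectedSpace_above (S := S) (H := H)
  haveI := finite_continuousCohomology_one_restrict_layerSubgroup hHo hNH hfin E hF hS
  exact Finite.of_equiv _ ((resRep K S H).shapiroOpenAddEquiv _
    (OpenSubgroupLayer.layerSubgroup S hHo E hF hS).isOpen' 1).toEquiv.symm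

include hNH hfin in
/-- **The `p`-torsion of `𝓗²(E_S) = H²(↥U, Maps(Δ, E_S))` is finite** (`K` totally complex).
[cite: NeukirchSchmidtWingberg2008, VIII §3 (8.3.11) (iii), I §6 Prop. (1.6.4)] -/
theorem finite_torsion_continuousCohomology_two_coindOpen_layer [IsTotallyComplex K] {p : ℕ} (hp : 0 < p) :
    {y : continuousCohomology 2 ((resRep K S H).coindOpen
      ((OpenSubgroupLayer.layerSubgroup S hHo E hF hS : OpenNormalSubgroup ↥(galoisGroupAbove S H)) :
        Subgroup ↥(galoisGroupAbove S H))
      (OpenSubgroupLayer.layerSubgroup S hHo E hF hS).isOpen').toTopRep | p • y = 0}.Finite := by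
  haveI := totallyDisconnectedSpace_above (S := S) (H := H)
  have hfin' := finite_torsion_continuousCohomology_two_restrict_layerSubgroup hHo hNH hfin E hF hS hp
  let f := (resRep K S H).shapiroOpenAddEquiv
    ((OpenSubgroupLayer.layerSubgroup S hHo E hF hS : OpenNormalSubgroup ↥(galoisGroupAbove S H)) :
      Subgroup ↥(galoisGroupAbove S H)) (OpenSubgroupLayer.layerSubgroup S hHo E hF hS).isOpen' 2
  refine (hfin'.image f.symm).subset fun y hy => ⟨f y, ?_, f.symm_apply_apply y⟩
  have hy' : p • y = 0 := hy
  change p • f y = 0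
  rw [← map_nsmul, hy', map_zero]

omit [CompactSpace ↥(galoisGroupAbove S H)] in
include hfin in
/-- `𝒪ˣ_{E,S}` (the `S`-units of the layer `E` for the places above `S`) is a finitely generated
`ℤ`-module (Dirichlet–Hasse–Chevalley, Mathlib). [cite: NeukirchSchmidtWingberg2008, (8.7.2)] -/
theorem moduleFinite_additive_sUnits_layer : Module.Finite ℤ (Additive (sUnits K S ↥E.1)) := by
  haveI := E.finiteDimensional
  haveI : NumberField ↥E.1 := E.numberField
  haveI : Finite {w : HeightOneSpectrum (𝓞 ↥E.1) | w.under (𝓞 K) ∈ S} :=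
    (EquivariantSUnit.finite_setOf_under_mem K (↥E.1) hfin).to_subtype
  rw [sUnits_eq_unit_setOf_under_mem (K := K) (S := S) (E := ↥E.1)]
  infer_instance

omit [CompactSpace ↥(galoisGroupAbove S H)] in
/-- The `p`-torsion of the finitely generated `𝒪ˣ_{E,S}` is finite (`p ≠ 0`).
[cite: NeukirchSchmidtWingberg2008, (8.7.2)] -/
theorem finite_torsionBy_additive_sUnits_layer [Module.Finite ℤ (Additive (sUnits K S ↥E.1))] {p : ℕ}
    (hp : p ≠ 0) : Finite (torsionBy ℤ (Additive (sUnits K S ↥E.1)) (p : ℤ)) := by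
  haveI : Module.Finite ℤ (torsionBy ℤ (Additive (sUnits K S ↥E.1)) (p : ℤ)) := inferInstance
  refine Module.finite_of_fg_torsion _ fun x =>
    ⟨⟨(p : ℤ), mem_nonZeroDivisors_of_ne_zero (by exact_mod_cast hp)⟩, ?_⟩
  rw [Submonoid.mk_smul]
  exact Subtype.ext ((mem_torsionBy_iff (p : ℤ) (x : Additive (sUnits K S ↥E.1))).1 x.2)

omit [CompactSpace ↥(galoisGroupAbove S H)] in
include hfin in
/-- **`E_S^W ≅ 𝒪ˣ_{E,S}` is a finitely generated `ℤ`-module** ((A2-β2) `layerModuleEquiv` + Dirichlet's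
`S`-unit theorem in Mathlib). [cite: NeukirchSchmidtWingberg2008, VIII §3 (8.3.11) (i), (8.7.2)] -/
theorem moduleFinite_invariantsOf_layerSubgroup :
    Module.Finite ℤ ((resRep K S H).invariantsOf
      ((OpenSubgroupLayer.layerSubgroup S hHo E hF hS : OpenNormalSubgroup ↥(galoisGroupAbove S H)) :
        Subgroup ↥(galoisGroupAbove S H))) := by
  haveI := moduleFinite_additive_sUnits_layer (S := S) hfin E
  exact Module.Finite.equiv (layerModuleEquiv hHo E hF hS).symm

omit [CompactSpace ↥(galoisGroupAbove S H)] in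
include hfin in
/-- `E_S^W/p` is finite (`p ≠ 0`). [cite: NeukirchSchmidtWingberg2008, (8.7.2)] -/
theorem finite_invariantsOf_layerSubgroup_quotient {p : ℕ} (hp : p ≠ 0) :
    Finite ((resRep K S H).invariantsOf
      ((OpenSubgroupLayer.layerSubgroup S hHo E hF hS : OpenNormalSubgroup ↥(galoisGroupAbove S H)) :
        Subgroup ↥(galoisGroupAbove S H)) ⧸
      ((p : ℤ) • ⊤ : Submodule ℤ ((resRep K S H).invariantsOf
        ((OpenSubgroupLayer.layerSubgroup S hHo E hF hS : OpenNormalSubgroup ↥(galoisGroupAbove S H)) :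
          Subgroup ↥(galoisGroupAbove S H))))) := by
  haveI := moduleFinite_invariantsOf_layerSubgroup hHo hfin E hF hS
  exact Int.finite_quotient_smul_top (by exact_mod_cast hp)

omit [CompactSpace ↥(galoisGroupAbove S H)] in
include hfin in
/-- `E_S^W[p]` is finite (`p ≠ 0`): it embeds into `𝒪ˣ_{E,S}[p]` along `layerModuleEquiv`.
[cite: NeukirchSchmidtWingberg2008, (8.7.2)] -/
theorem finite_invariantsOf_layerSubgroup_torsionBy {p : ℕ} (hp : p ≠ 0) :
    Finite (torsionBy ℤ ((resRep K S H).invariantsOf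
      ((OpenSubgroupLayer.layerSubgroup S hHo E hF hS : OpenNormalSubgroup ↥(galoisGroupAbove S H)) :
        Subgroup ↥(galoisGroupAbove S H))) (p : ℤ)) := by
  haveI := moduleFinite_additive_sUnits_layer (S := S) hfin E
  haveI := finite_torsionBy_additive_sUnits_layer (S := S) E hp
  have hmem : ∀ x : torsionBy ℤ ((layerRep hHo E hF hS).V) (p : ℤ),
      layerModuleEquiv hHo E hF hS x ∈ torsionBy ℤ (Additive (sUnits K S ↥E.1)) (p : ℤ) := fun x => by
    rw [mem_torsionBy_iff, ← map_smul, (mem_torsionBy_iff _ _).1 x.2, map_zero]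
  refine Finite.of_injective (fun x : torsionBy ℤ ((layerRep hHo E hF hS).V) (p : ℤ) =>
    (⟨layerModuleEquiv hHo E hF hS x, hmem x⟩ : torsionBy ℤ (Additive (sUnits K S ↥E.1)) (p : ℤ)))
    fun x y hxy => ?_
  exact Subtype.ext ((layerModuleEquiv hHo E hF hS).injective (congrArg Subtype.val hxy))

end Finiteness

/-! ## §4 `p`-divisibility of `E_S` and `𝓗⁰(E_S) = E_S^W = 𝒪ˣ_{E,S}` as a `Δ`-module -/

section DegreeZero

variable (hHo : IsOpen (H : Set (absoluteGaloisGroup K))) (E : GalLayer K) (hF : baseField H ≤ E.1)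
  (hS : ramificationSubgroup K S ≤ galFixing K E.1) {p : ℕ}

variable {A : Type*} [AddCommGroup A]
variable (ψ : ∀ ⦃X : Type⦄ ⦃_ : AddCommGroup X⦄ ⦃_ : Module ℤ X⦄,
    Representation ℤ (↥(galoisGroupAbove S H) ⧸
      ((OpenSubgroupLayer.layerSubgroup S hHo E hF hS : OpenNormalSubgroup ↥(galoisGroupAbove S H)) :
        Subgroup ↥(galoisGroupAbove S H))) X → A)
  (hψ : ∀ ⦃X Y Z : Type⦄ [AddCommGroup X] [Module ℤ X] [AddCommGroup Y] [Module ℤ Y]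
    [AddCommGroup Z] [Module ℤ Z]
    (ρX : Representation ℤ (↥(galoisGroupAbove S H) ⧸
      ((OpenSubgroupLayer.layerSubgroup S hHo E hF hS : OpenNormalSubgroup ↥(galoisGroupAbove S H)) :
        Subgroup ↥(galoisGroupAbove S H))) X)
    (ρY : Representation ℤ (↥(galoisGroupAbove S H) ⧸
      ((OpenSubgroupLayer.layerSubgroup S hHo E hF hS : OpenNormalSubgroup ↥(galoisGroupAbove S H)) :
        Subgroup ↥(galoisGroupAbove S H))) Y)
    (ρZ : Representation ℤ (↥(galoisGroupAbove S H) ⧸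
      ((OpenSubgroupLayer.layerSubgroup S hHo E hF hS : OpenNormalSubgroup ↥(galoisGroupAbove S H)) :
        Subgroup ↥(galoisGroupAbove S H))) Z) (f : X →ₗ[ℤ] Y) (g : Y →ₗ[ℤ] Z),
    (∀ s x, f (ρX s x) = ρY s (f x)) → (∀ s y, g (ρY s y) = ρZ s (g y)) →
    Injective f → Surjective g → LinearMap.range f = LinearMap.ker g → Finite Y →
    (∀ y : Y, (p : ℤ) • y = 0) → ψ ρY = ψ ρX + ψ ρZ)
include hψ

/-- **`E_S^W/p ≅ (𝒪ˣ_{E,S}/p)` as `Δ ≃ Gal(E/F₀)`-modules, `ψ`-form**: the `Δ`-action on the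
`W = Gal(K_S/E)`-invariants of `E_S|_U` (`ContinuousRep.quotientInvariants`) is the Galois action on
`𝒪ˣ_{E,S}` (`sUnitsRepρ K S F₀ E`) pulled back along `layerEquiv : Δ ≃* Gal(E/F₀)` ((A2-β2)
`layerModuleEquiv_comm`). [cite: NeukirchSchmidtWingberg2008, VIII §3 (8.3.11) (i)] [cite: Harari2020, §13.1] -/
theorem additive_quotientInvariants_quotient_eq_sUnitsRep [Fact p.Prime] (hfin : S.Finite) :
    ψ (((resRep K S H).quotientInvariants
        ((OpenSubgroupLayer.layerSubgroup S hHo E hF hS : OpenNormalSubgroup ↥(galoisGroupAbove S H)) :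
          Subgroup ↥(galoisGroupAbove S H))).toRepresentation.quotient ((p : ℤ) • ⊤)
        (smul_top_le_comap _ (p : ℤ))) =
      ψ (letI := algOfLE hF;
        Representation.quotient
          ((EquivariantSUnit.sUnitsRepρ K S ↥(baseField H) ↥E.1).comp
            (OpenSubgroupLayer.layerEquiv S hHo E hF hS).toMonoidHom)
          ((p : ℤ) • ⊤) (smul_top_le_comap _ (p : ℤ))) := by
  letI := algOfLE hF
  haveI := moduleFinite_additive_sUnits_layer (S := S) hfin E
  haveI : Finite (Additive (sUnits K S ↥E.1) ⧸ ((p : ℤ) • ⊤ : Submodule ℤ (Additive (sUnits K S ↥E.1)))) :=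
    Int.finite_quotient_smul_top
      (by exact_mod_cast (Fact.out : p.Prime).ne_zero)
  refine Int.additive_reduction_eq_of_linearEquiv
    ψ hψ _ _ (layerModuleEquiv hHo E hF hS) (fun c x => ?_)
  exact LinearMap.congr_fun (layerModuleEquiv_comm hHo E hF hS c) x

/-- **`E_S^W[p] ≅ 𝒪ˣ_{E,S}[p]` as `Δ ≃ Gal(E/F₀)`-modules, `ψ`-form** (the `p`-th roots of unity of `E`
with their Galois action, pulled back along `layerEquiv`). [cite: NeukirchSchmidtWingberg2008, VIII §3 (8.3.11) (i)]
[cite: Harari2020, §13.1] -/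
theorem additive_quotientInvariants_torsionBy_eq_sUnitsRep [Fact p.Prime] (hfin : S.Finite) :
    ψ (((resRep K S H).quotientInvariants
        ((OpenSubgroupLayer.layerSubgroup S hHo E hF hS : OpenNormalSubgroup ↥(galoisGroupAbove S H)) :
          Subgroup ↥(galoisGroupAbove S H))).toRepresentation.subrepresentation (torsionBy ℤ _ (p : ℤ))
        (torsionBy_le_comap _ (p : ℤ))) =
      ψ (letI := algOfLE hF;
        Representation.subrepresentation
          ((EquivariantSUnit.sUnitsRepρ K S ↥(baseField H) ↥E.1).comp
            (OpenSubgroupLayer.layerEquiv S hHo E hF hS).toMonoidHom)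
          (torsionBy ℤ (Additive (sUnits K S ↥E.1)) (p : ℤ)) (torsionBy_le_comap _ (p : ℤ))) := by
  letI := algOfLE hF
  haveI := moduleFinite_additive_sUnits_layer (S := S) hfin E
  haveI := finite_torsionBy_additive_sUnits_layer (S := S) E (Fact.out : p.Prime).ne_zero
  refine Literature.RepresentationTheory.FiniteGroups.StableLatticeReduction.Poly.additive_subrepresentation_eq_of_linearEquiv
    ψ hψ _ _ _ _ _ _ (layerModuleEquiv hHo E hF hS)
    (fun c x => LinearMap.congr_fun (layerModuleEquiv_comm hHo E hF hS c) x) (fun x => ?_) (fun y => ?_)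
  · rw [mem_torsionBy_iff, mem_torsionBy_iff]
    exact (Iff.of_eq (congrArg (fun t => t = 0)
      ((layerModuleEquiv hHo E hF hS).map_smul (p : ℤ) x).symm)).trans
        (layerModuleEquiv hHo E hF hS).map_eq_zero_iff
  · exact Subtype.ext ((mem_torsionBy_iff (p : ℤ) (y : Additive (sUnits K S ↥E.1))).1 y.2)

end DegreeZero

end Layers

end SUnits

end Literature.NumberTheory.GaloisRepresentations

end
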